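import Summits.HubbardSuperconductivity.HubbardSuperconductivity.Theorems.AposterioriCapRgDefs
import Literature.MathematicalPhysics.QuantumLattice.XYOrderDischarges
import Literature.MathematicalPhysics.QuantumLattice.GroundStateSourceBounds
import Literature.MathematicalPhysics.QuantumLattice.LatticeToriProofs

/-!
# `XYOrderOpennessLargeSpin`, line `feynman-sector-gap`: the double commutator with the
# perturbation (`stub_doubleCommutatorW`)

Crux item stmt-HubbardSuperconductivity-13895 (route `AposterioriCapRg`), vocabulary of
`Theorems/AposterioriCapRgDefs.lean`. For the Fourier modes `A = Ŝ^α_q = Σ_y c_y S^α_y`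
(`|c_y| = 1`) of the spin-`n/2` torus `(ℤ/Lℤ)²`, a perturbation `W = Σ_z w_z` whose rules `w_z`
are supported on the `ℓ∞` balls `torusBall z r` and are Hermitian with spectrum in `[-1, 1]`
(`LocalRuleSum n r L W`), and ANY Hermitian `H'` (whose tracial ground state `ω'` plays the role
of an arbitrary state):

`|Re ω'([Aᴴ, [W, A]])| ≤ n² (2r+1)⁴ L²`   (`doubleComm A X = [Aᴴ, [X, A]]`, `K₂ = 1`).

Proof (locality bookkeeping for the double-commutator bound of Kennedy–Lieb–Shastry,
J. Stat. Phys. 53 (1988) 1019, eq. (13), made state-independent):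
* `|Re ω'(D)| ≤ ‖D‖` (`abs_re_groundStateFunctional_le_norm`, L²-operator norm);
* bilinearity: `D = Σ_x Σ_z Σ_y conj(c_x) c_y [S^α_x, [w_z, S^α_y]]`, so
  `‖D‖ ≤ Σ_z Σ_x Σ_y ‖[S^α_x, [w_z, S^α_y]]‖`;
* locality (`commute_of_disjoint_holds`): `[w_z, S_y] = 0` unless `y ∈ torusBall z r`, and then
  `[w_z, S_y]` is supported on the ball, so `[S_x, [w_z, S_y]] = 0` unless `x ∈ torusBall z r`;
  each surviving term has norm `≤ 2‖S‖ · 2‖w_z‖‖S‖ ≤ 4 (n/2)² = n²` (`‖w_z‖ ≤ 1` is the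
  eigenvalue clause, through the isometric functional calculus `‖a‖ = sup |σ(a)|`);
* `#torusBall z r ≤ (2r+1)²` and `L²` centres `z`.
-/

noncomputable section

namespace Summit.HubbardSuperconductivity.HubbardSuperconductivity.Theorems.XYOrderOpennessLargeSpin

set_option linter.dupNamespace false -- summit = problem name (single-conjunct summit), D-0017

open Matrix Complex Finset
open scoped ComplexOrder Matrix.Norms.L2Operator
open Literature.MathematicalPhysics.QuantumLattice Literature.Probability.LatticeModels

/-! ### The ring commutator `⁅A, B⁆ = AB - BA` of complex matrices: bilinearity, norm -/

section RingBracket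

variable {m : Type*} [Fintype m]

/-- `⁅c • A, B⁆ = c • ⁅A, B⁆`. [folklore] -/
private theorem mx_smul_lie (c : ℂ) (A B : Matrix m m ℂ) : ⁅c • A, B⁆ = c • ⁅A, B⁆ := by
  -- adapted from the landed sibling stub `stub_doubleCommutatorXY`
  rw [Ring.lie_def, Ring.lie_def, smul_mul_assoc, mul_smul_comm, smul_sub]

/-- `⁅A, c • B⁆ = c • ⁅A, B⁆`. [folklore] -/
private theorem mx_lie_smul (c : ℂ) (A B : Matrix m m ℂ) : ⁅A, c • B⁆ = c • ⁅A, B⁆ := by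
  rw [Ring.lie_def, Ring.lie_def, mul_smul_comm, smul_mul_assoc, smul_sub]

/-- `⁅Σ_i A_i, C⁆ = Σ_i ⁅A_i, C⁆`. [folklore] -/
private theorem mx_sum_lie {ι : Type*} (s : Finset ι) (A : ι → Matrix m m ℂ) (C : Matrix m m ℂ) :
    ⁅∑ i ∈ s, A i, C⁆ = ∑ i ∈ s, ⁅A i, C⁆ := by
  simp only [Ring.lie_def, Finset.sum_mul, Finset.mul_sum, Finset.sum_sub_distrib]

/-- `⁅C, Σ_i A_i⁆ = Σ_i ⁅C, A_i⁆`. [folklore] -/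
private theorem mx_lie_sum {ι : Type*} (s : Finset ι) (A : ι → Matrix m m ℂ) (C : Matrix m m ℂ) :
    ⁅C, ∑ i ∈ s, A i⁆ = ∑ i ∈ s, ⁅C, A i⁆ := by
  simp only [Ring.lie_def, Finset.sum_mul, Finset.mul_sum, Finset.sum_sub_distrib]

/-- `⁅A, 0⁆ = 0`. [folklore] -/
private theorem mx_lie_zero (A : Matrix m m ℂ) : ⁅A, (0 : Matrix m m ℂ)⁆ = 0 := by
  rw [Ring.lie_def, mul_zero, zero_mul, sub_zero]

variable [DecidableEq m]

/-- `‖⁅A, B⁆‖ ≤ 2 ‖A‖ ‖B‖` (L²-operator norm). [folklore] -/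
private theorem norm_lie_le (A B : Matrix m m ℂ) : ‖⁅A, B⁆‖ ≤ 2 * ‖A‖ * ‖B‖ := by
  rw [Ring.lie_def]
  calc ‖A * B - B * A‖ ≤ ‖A * B‖ + ‖B * A‖ := norm_sub_le _ _
    _ ≤ ‖A‖ * ‖B‖ + ‖B‖ * ‖A‖ := add_le_add (norm_mul_le _ _) (norm_mul_le _ _)
    _ = 2 * ‖A‖ * ‖B‖ := by ring

/-- **The eigenvalue clause bounds the operator norm**: a Hermitian matrix with all eigenvalues
in `[-1, 1]` has L²-operator norm `≤ 1` (`‖a‖ = ‖cfc id a‖ ≤ sup_{σ(a)} |id|` for self-adjoint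
`a` by the isometric continuous functional calculus, and `σ_ℝ(a)` is the set of eigenvalues).
[folklore] -/
private theorem norm_le_one_of_eig {w : Matrix m m ℂ} (hw : w.IsHermitian)
    (h : ∀ i, |hw.eigenvalues i| ≤ 1) : ‖w‖ ≤ 1 := by
  have hsa : IsSelfAdjoint w := hw.isSelfAdjoint
  calc ‖w‖ = ‖cfc (id : ℝ → ℝ) w‖ := by rw [cfc_id ℝ w]
    _ ≤ 1 := norm_cfc_le zero_le_one fun x hx => by
        rw [hw.spectrum_real_eq_range_eigenvalues] at hx
        obtain ⟨i, rfl⟩ := hx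
        rw [id, Real.norm_eq_abs]
        exact h i

end RingBracket

/-! ### Locality: supports of commutators, the norm of a spin -/

section Locality

variable {Λ : Type*} [Fintype Λ] [DecidableEq Λ]

/-- `𝔄_X` is closed under commutators. [folklore] -/
private theorem isSupportedOn_lie {q : ℕ} {A B : Op Λ q} {X : Finset Λ} (hA : IsSupportedOn A X)
    (hB : IsSupportedOn B X) : IsSupportedOn ⁅A, B⁆ X := by
  rw [Ring.lie_def, sub_eq_add_neg, ← neg_one_smul ℂ (B * A)]
  exact (IsSupportedOn.mul_holds hA hB).add ((IsSupportedOn.mul_holds hB hA).smul _)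

/-- Locality for commutators: `[A, B] = 0` for `A ∈ 𝔄_X`, `B ∈ 𝔄_Y`, `X ∩ Y = ∅`. [folklore] -/
private theorem lie_eq_zero_of_disjoint {q : ℕ} {A B : Op Λ q} {X Y : Finset Λ}
    (hA : IsSupportedOn A X) (hB : IsSupportedOn B Y) (h : Disjoint X Y) : ⁅A, B⁆ = 0 :=
  (commute_of_disjoint_holds hA hB h).lie_eq

/-- `S^α_x ∈ 𝔄_{{x}}`. [folklore] -/
private theorem isSupportedOn_siteSpin (n : ℕ) (x : Λ) (α : Fin 3) :
    IsSupportedOn (siteSpin n x α : Op Λ (n + 1)) {x} :=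
  isSupportedOn_onSite_holds x (spinVec n α)

open scoped MatrixOrder in
/-- `‖S^γ_x‖ ≤ S = n/2` (L²-operator norm): `0 ≤ (S^γ_x)ᴴ S^γ_x = (S^γ_x)² ≤ S²·1` in the Loewner
order (`posSemidef_sq_smul_one_sub_siteSpin_sq`), the norm is monotone on the positive cone of the
matrix C⋆-algebra, and `‖Tᴴ T‖ = ‖T‖²`. [folklore] -/
private theorem norm_siteSpin_le (n : ℕ) (x : Λ) (γ : Fin 3) :
    ‖(siteSpin n x γ : Op Λ (n + 1))‖ ≤ (n : ℝ) / 2 := by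
  -- adapted from the landed sibling stub `stub_doubleCommutatorXY`
  letI : CStarAlgebra (Op Λ (n + 1)) := {}
  set T : Op Λ (n + 1) := siteSpin n x γ
  have hH : Tᴴ = T := (siteSpin_isHermitian n x γ).eq
  have h0 : (0 : Op Λ (n + 1)) ≤ T * T := by
    rw [Matrix.nonneg_iff_posSemidef]
    nth_rewrite 1 [← hH]
    exact posSemidef_conjTranspose_mul_self T
  have h1 : T * T ≤ (((n : ℂ) / 2) ^ 2) • (1 : Op Λ (n + 1)) := by
    rw [Matrix.le_iff]
    exact posSemidef_sq_smul_one_sub_siteSpin_sq n x γ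
  have h2 : ‖T * T‖ ≤ ‖(((n : ℂ) / 2) ^ 2) • (1 : Op Λ (n + 1))‖ :=
    CStarAlgebra.norm_le_norm_of_nonneg_of_le h0 h1
  have h3 : ‖T * T‖ = ‖T‖ * ‖T‖ := by
    nth_rewrite 1 [← hH]
    exact Matrix.l2_opNorm_conjTranspose_mul_self T
  have h4 : ‖(((n : ℂ) / 2) ^ 2) • (1 : Op Λ (n + 1))‖ = ((n : ℝ) / 2) ^ 2 := by
    rw [norm_smul, CStarRing.norm_one, mul_one,
      show ((n : ℂ) / 2) ^ 2 = ((((n : ℝ) / 2) ^ 2 : ℝ) : ℂ) by push_cast; ring, Complex.norm_real,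
      Real.norm_of_nonneg (by positivity)]
  rw [h3, h4] at h2
  have hS : (0 : ℝ) ≤ (n : ℝ) / 2 := by positivity
  nlinarith [norm_nonneg T, h2, hS]

/-- **The double sum over one local rule.** For `w ∈ 𝔄_B` with `‖w‖ ≤ 1`:
`Σ_x Σ_y ‖[S^α_x, [w, S^α_y]]‖ ≤ n² (#B)²` — the inner commutator vanishes unless `y ∈ B` and is
then supported on `B`, so the outer one vanishes unless `x ∈ B`; each surviving term is bounded by
`2‖S‖ · 2‖w‖‖S‖ ≤ n²`. [cite: KLS1988JSP, eq. (13)] -/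
private theorem sum_sum_norm_lie_lie_le (n : ℕ) {B : Finset Λ} {w : Op Λ (n + 1)}
    (hw : IsSupportedOn w B) (hw1 : ‖w‖ ≤ 1) (α : Fin 3) :
    ∑ x : Λ, ∑ y : Λ, ‖⁅(siteSpin n x α : Op Λ (n + 1)), ⁅w, siteSpin n y α⁆⁆‖ ≤
      (n : ℝ) ^ 2 * (B.card : ℝ) ^ 2 := by
  -- locality
  have hin0 : ∀ y : Λ, y ∉ B → ⁅w, (siteSpin n y α : Op Λ (n + 1))⁆ = 0 := fun y hy =>
    lie_eq_zero_of_disjoint hw (isSupportedOn_siteSpin n y α)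
      (Finset.disjoint_singleton_right.2 hy)
  have hin : ∀ y : Λ, y ∈ B → IsSupportedOn ⁅w, (siteSpin n y α : Op Λ (n + 1))⁆ B :=
      fun y hy =>
    isSupportedOn_lie hw (IsSupportedOn.mono_holds (isSupportedOn_siteSpin n y α)
      (Finset.singleton_subset_iff.2 hy))
  have hout0 : ∀ x : Λ, x ∉ B → ∀ y : Λ,
      ⁅(siteSpin n x α : Op Λ (n + 1)), ⁅w, siteSpin n y α⁆⁆ = 0 := by
    intro x hx y
    by_cases hy : y ∈ B
    · exact lie_eq_zero_of_disjoint (isSupportedOn_siteSpin n x α) (hin y hy)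
        (Finset.disjoint_singleton_left.2 hx)
    · rw [hin0 y hy, mx_lie_zero]
  -- the norm of one term
  have hS : (0 : ℝ) ≤ (n : ℝ) / 2 := by positivity
  have hterm : ∀ x y : Λ,
      ‖⁅(siteSpin n x α : Op Λ (n + 1)), ⁅w, siteSpin n y α⁆⁆‖ ≤ (n : ℝ) ^ 2 := by
    intro x y
    calc ‖⁅(siteSpin n x α : Op Λ (n + 1)), ⁅w, siteSpin n y α⁆⁆‖
        ≤ 2 * ‖(siteSpin n x α : Op Λ (n + 1))‖ * ‖⁅w, (siteSpin n y α : Op Λ (n + 1))⁆‖ :=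
          norm_lie_le _ _
      _ ≤ 2 * ‖(siteSpin n x α : Op Λ (n + 1))‖ * (2 * ‖w‖ * ‖(siteSpin n y α : Op Λ (n + 1))‖) :=
          mul_le_mul_of_nonneg_left (norm_lie_le _ _)
            (mul_nonneg zero_le_two (norm_nonneg _))
      _ ≤ 2 * ((n : ℝ) / 2) * (2 * 1 * ((n : ℝ) / 2)) :=
          mul_le_mul (mul_le_mul_of_nonneg_left (norm_siteSpin_le n x α) zero_le_two)
            (mul_le_mul (mul_le_mul_of_nonneg_left hw1 zero_le_two) (norm_siteSpin_le n y α)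
              (norm_nonneg _) (by norm_num))
            (mul_nonneg (mul_nonneg zero_le_two (norm_nonneg _)) (norm_nonneg _))
            (mul_nonneg zero_le_two hS)
      _ = (n : ℝ) ^ 2 := by ring
  -- restrict both sums to the ball and count
  calc ∑ x : Λ, ∑ y : Λ, ‖⁅(siteSpin n x α : Op Λ (n + 1)), ⁅w, siteSpin n y α⁆⁆‖
      = ∑ x ∈ B, ∑ y : Λ, ‖⁅(siteSpin n x α : Op Λ (n + 1)), ⁅w, siteSpin n y α⁆⁆‖ := by
        refine (Finset.sum_subset (Finset.subset_univ B) fun x _ hx => ?_).symm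
        simp only [hout0 x hx, norm_zero, Finset.sum_const_zero]
    _ = ∑ x ∈ B, ∑ y ∈ B, ‖⁅(siteSpin n x α : Op Λ (n + 1)), ⁅w, siteSpin n y α⁆⁆‖ := by
        refine Finset.sum_congr rfl fun x _ => ?_
        refine (Finset.sum_subset (Finset.subset_univ B) fun y _ hy => ?_).symm
        rw [hin0 y hy, mx_lie_zero, norm_zero]
    _ ≤ ∑ _x ∈ B, ∑ _y ∈ B, (n : ℝ) ^ 2 :=
        Finset.sum_le_sum fun x _ => Finset.sum_le_sum fun y _ => hterm x y
    _ = (n : ℝ) ^ 2 * (B.card : ℝ) ^ 2 := by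
        simp only [Finset.sum_const, nsmul_eq_mul]
        ring

end Locality

/-! ### Counting: torus balls -/

section Counting

variable {d L : ℕ} [NeZero L]

/-- The sublevel set of the torus norm sits in the product of the coordinate sublevel sets.
[folklore] -/
private theorem filter_torusNorm_le_subset_piFinset (r : ℕ) :
    (univ.filter fun z : TorusSite d L => torusNorm z ≤ r) ⊆
      Fintype.piFinset fun _ : Fin d =>
        univ.filter fun c : ZMod L => min c.val (L - c.val) ≤ r := by
  -- adapted from `filter_torusNorm_le_subset_piFinset` (Literature/.../QuasiLocalPiecesProofs.lean)
  intro z hz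
  simp only [mem_filter, mem_univ, true_and] at hz
  rw [Fintype.mem_piFinset]
  intro i
  simp only [mem_filter, mem_univ, true_and]
  exact (Finset.le_sup (f := fun i : Fin d => min (z i).val (L - (z i).val)) (mem_univ i)).trans hz

/-- Balls of the torus norm have at most `(2r+1)^d` points, uniformly in `L`. [folklore] -/
private theorem card_filter_torusNorm_le (r : ℕ) :
    (univ.filter fun z : TorusSite d L => torusNorm z ≤ r).card ≤ (2 * r + 1) ^ d := by
  -- adapted from `card_filter_torusNorm_le` (Literature/.../QuasiLocalPiecesProofs.lean)
  refine (card_le_card (filter_torusNorm_le_subset_piFinset r)).trans ?_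
  rw [Fintype.card_piFinset, prod_const, card_univ, Fintype.card_fin]
  exact Nat.pow_le_pow_left (card_filter_cyclicAbs_le_le r) d

/-- Torus balls have at most `(2r+1)^d` points (translate to the origin). [folklore] -/
private theorem card_torusBall_le (x : TorusSite d L) (r : ℕ) :
    (torusBall x r).card ≤ (2 * r + 1) ^ d := by
  -- adapted from `card_torusBall_le` (Literature/.../QuasiLocalPiecesProofs.lean)
  have h : torusBall x r = (univ.filter fun z : TorusSite d L => torusNorm z ≤ r).image
      fun z => x - z := by
    ext y
    simp only [mem_torusBall_iff, mem_image, mem_filter, mem_univ, true_and, torusDist]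
    constructor
    · intro hy
      exact ⟨x - y, hy, sub_sub_cancel x y⟩
    · rintro ⟨z, hz, rfl⟩
      rwa [sub_sub_cancel]
  rw [h]
  exact card_image_le.trans (card_filter_torusNorm_le r)

end Counting

/-! ### The stub -/

/-- **Double commutator with a local perturbation is `O(n² r⁴ L²)` in every state** (stub
`stub_doubleCommutatorW` of the line `feynman-sector-gap`). For the modes `A = Ŝ^α_q` of the
spin-`n/2` torus `(ℤ/Lℤ)²`, a perturbation `W = Σ_z w_z` with `w_z ∈ 𝔄_{torusBall z r}` Hermitian
with spectrum in `[-1,1]` (`LocalRuleSum n r L W`), and ANY Hermitian `H'`: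
`|Re ω_{H'}([Aᴴ,[W, A]])| ≤ n² (2r+1)⁴ L²` (`K₂ = 1`).
`|Re ω'(D)| ≤ ‖D‖`; `D = Σ_x Σ_z Σ_y conj(c_x) c_y [S^α_x,[w_z,S^α_y]]` with `|c| = 1`; per centre
`z` the double site sum is `≤ n² (#torusBall z r)² ≤ n² (2r+1)⁴` by locality
(`sum_sum_norm_lie_lie_le`, `card_torusBall_le`); `L²` centres. KLS, J. Stat. Phys. 53 (1988),
eq. (13) (the double-commutator / `f`-sum object). [cite: KLS1988JSP, eq. (13)] -/
theorem stub_doubleCommutatorW :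
    ∃ K₂ : ℝ, 0 < K₂ ∧ ∀ (n r L : ℕ) [NeZero L] (W : Op (TorusSite 2 L) (n + 1)),
      LocalRuleSum n r L W →
      ∀ (H' : Op (TorusSite 2 L) (n + 1)), H'.IsHermitian →
      ∀ (q : TorusSite 2 L) (α : Fin 3),
        |(H'.groundStateFunctional (doubleComm (spinMode L n q α) W)).re| ≤
          K₂ * (n : ℝ) ^ 2 * (2 * (r : ℝ) + 1) ^ 4 * (L : ℝ) ^ 2 := by
  refine ⟨1, one_pos, ?_⟩
  intro n r L _ W hW H' hH' q α
  obtain ⟨w, rfl, hw⟩ := hW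
  -- the phases `c_x = e^{-ip·x}`
  set c : TorusSite 2 L → ℂ := fun x => cexp (-(I * (torusPhase L q x : ℂ))) with hc
  have hc1 : ∀ x, ‖c x‖ = 1 := fun x => by simp [hc, Complex.norm_exp]
  -- `|Λ| = L²`
  have hcardT : (Fintype.card (TorusSite 2 L) : ℝ) = (L : ℝ) ^ 2 := by
    rw [Fintype.card_pi, prod_const, ZMod.card, card_univ, Fintype.card_fin]
    push_cast
    ring
  -- the mode and its adjoint
  have hA : spinMode L n q α = ∑ y : TorusSite 2 L, c y • siteSpin n y α := rfl
  have hAH : (spinMode L n q α)ᴴ = ∑ x : TorusSite 2 L, star (c x) • siteSpin n x α := by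
    rw [hA, conjTranspose_sum]
    refine sum_congr rfl fun x _ => ?_
    rw [conjTranspose_smul, (siteSpin_isHermitian n x α).eq]
  -- bilinear expansion of the double commutator
  have hXA : ⁅∑ z : TorusSite 2 L, w z, spinMode L n q α⁆ = ∑ z : TorusSite 2 L,
      ∑ y : TorusSite 2 L, c y • ⁅w z, (siteSpin n y α : Op (TorusSite 2 L) (n + 1))⁆ := by
    rw [hA, mx_sum_lie]
    refine sum_congr rfl fun z _ => ?_
    rw [mx_lie_sum]
    refine sum_congr rfl fun y _ => ?_
    rw [mx_lie_smul]
  have hD : doubleComm (spinMode L n q α) (∑ z : TorusSite 2 L, w z) =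
      ∑ x : TorusSite 2 L, ∑ z : TorusSite 2 L, ∑ y : TorusSite 2 L, (star (c x) * c y) •
        ⁅(siteSpin n x α : Op (TorusSite 2 L) (n + 1)), ⁅w z, siteSpin n y α⁆⁆ := by
    show ⁅(spinMode L n q α)ᴴ, ⁅∑ z : TorusSite 2 L, w z, spinMode L n q α⁆⁆ = _
    rw [hXA, hAH, mx_sum_lie]
    refine sum_congr rfl fun x _ => ?_
    rw [mx_smul_lie, mx_lie_sum, Finset.smul_sum]
    refine sum_congr rfl fun z _ => ?_
    rw [mx_lie_sum, Finset.smul_sum]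
    refine sum_congr rfl fun y _ => ?_
    rw [mx_lie_smul, smul_smul]
  -- per centre: `n² (2r+1)⁴`
  have hcentre : ∀ z : TorusSite 2 L, ∑ x : TorusSite 2 L, ∑ y : TorusSite 2 L,
      ‖⁅(siteSpin n x α : Op (TorusSite 2 L) (n + 1)), ⁅w z, siteSpin n y α⁆⁆‖ ≤
        (n : ℝ) ^ 2 * (2 * (r : ℝ) + 1) ^ 4 := by
    intro z
    obtain ⟨hsupp, hherm, heig⟩ := hw z
    have hcard : ((torusBall z r).card : ℝ) ≤ (2 * (r : ℝ) + 1) ^ 2 := by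
      exact_mod_cast card_torusBall_le z r
    calc _ ≤ (n : ℝ) ^ 2 * ((torusBall z r).card : ℝ) ^ 2 :=
          sum_sum_norm_lie_lie_le n hsupp (norm_le_one_of_eig hherm heig) α
      _ ≤ (n : ℝ) ^ 2 * ((2 * (r : ℝ) + 1) ^ 2) ^ 2 := by gcongr
      _ = (n : ℝ) ^ 2 * (2 * (r : ℝ) + 1) ^ 4 := by ring
  -- the operator norm of the double commutator
  have hnormD : ‖doubleComm (spinMode L n q α) (∑ z : TorusSite 2 L, w z)‖ ≤
      (n : ℝ) ^ 2 * (2 * (r : ℝ) + 1) ^ 4 * (L : ℝ) ^ 2 := by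
    rw [hD]
    have hs : ∀ x y, ‖star (c x) * c y‖ = 1 := by
      intro x y
      rw [norm_mul, norm_star, hc1, hc1, one_mul]
    refine (norm_sum_le _ _).trans ?_
    refine (Finset.sum_le_sum fun x _ => (norm_sum_le _ _).trans <|
      Finset.sum_le_sum fun z _ => norm_sum_le _ _).trans ?_
    simp only [norm_smul, hs, one_mul]
    rw [Finset.sum_comm]
    calc ∑ z : TorusSite 2 L, ∑ x : TorusSite 2 L, ∑ y : TorusSite 2 L,
          ‖⁅(siteSpin n x α : Op (TorusSite 2 L) (n + 1)), ⁅w z, siteSpin n y α⁆⁆‖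
        ≤ ∑ _z : TorusSite 2 L, (n : ℝ) ^ 2 * (2 * (r : ℝ) + 1) ^ 4 :=
          sum_le_sum fun z _ => hcentre z
      _ = (n : ℝ) ^ 2 * (2 * (r : ℝ) + 1) ^ 4 * (L : ℝ) ^ 2 := by
          rw [sum_const, card_univ, nsmul_eq_mul, hcardT]
          ring
  -- the state: `|Re ω'(D)| ≤ ‖D‖`
  rw [one_mul]
  exact (abs_re_groundStateFunctional_le_norm hH' _).trans hnormD

end Summit.HubbardSuperconductivity.HubbardSuperconductivity.Theorems.XYOrderOpennessLargeSpin

end
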